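import Mathlib.Analysis.Fourier.PoissonSummation
import Mathlib.MeasureTheory.Measure.Haar.NormedSpace
import Mathlib.Analysis.PSeries
import Mathlib.NumberTheory.DirichletCharacter.GaussSum
import Mathlib.Analysis.SpecialFunctions.Complex.CircleAddChar
import HarnessLib

/-!
# Poisson summation along an arithmetic progression, and its twist by a primitive character, for a band-limited function

Topic `Literature/Analysis/Fourier`. Everything here is PROVED (Mathlib's Poisson summation formula
`Real.tsum_eq_tsum_fourier_of_rpow_decay` and Gauss sums `gaussSum_mulShift_of_isPrimitive`); no
definitions, no named facts. Written by the literature-typing seat `littype-FP2-1` (cell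
`parity-realchar`, D-0088 (4) row (7)) as the summation engine of Ramaré's approximate formulae for
`L(1, χ)` (O. Ramaré, *Approximate formulae for `L(1, χ)`*, Acta Arith. 100 (2001) 245–266, §II):

* **Lemma 1** (p. 249, after Berndt): «Let `ϑ` be a function of period `q`. Let `ψ : ℝ → ℝ` be a compactly
  supported `C⁰` function. Then `Σ_{n∈ℤ} ϑ(n)ψ(n) = Σ_{m∈ℤ} ϑ̂(m) ψ̂(m/q)` where
  `ϑ̂(m) = q⁻¹ Σ_{a mod q} ϑ(a)e(−am/q)`. Proof. We split the first sum in arithmetic progressions modulo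
  `q`, then apply the Poisson summation formula to each resulting sum»;
* **(2.1)** (p. 249): «In the case when `ϑ` is a primitive character `χ` with conductor `q`, we have
  `q⁻¹ Σ_{a mod q} χ(a)e(ma/q) = χ(−1)τ(χ)χ̄(m)/q`, whose modulus is `1/√q` or `0`.»

We use it "from the Fourier side": the test function is `V(y) = ∫ G(u)e^{2πiuy} du` with `G` continuous,
`G = 0` off `(−1, 1)` (band-limited `V`) and `|V(y)| ≤ C/(1+y²)`; Poisson summation is applied to the
compactly supported `t ↦ (δq)⁻¹ e(at/q) G(t/(δq))`, whose Fourier transform is `ξ ↦ V(δ(a − qξ))`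
(`fourier_modulated_dilate`), so that no Fourier inversion is needed.

* `tsum_progression_eq_of_bandlimited` — `Σ_{k∈ℤ} V(δ(a+qk)) = (δq)⁻¹ Σ_{n∈ℤ} e(an/q) G(n/(δq))`;
* `tsum_int_eq_sum_residues` / `_zmod` — splitting `Σ_{n∈ℤ} c(n)F(n)` into residue classes;
* `sum_char_mul_exp_eq` — `Σ_{b mod q} χ(b)e(bm/q) = χ̄(m)τ(χ)` for primitive `χ` ((2.1) up to `m ↦ −m`);
* **`tsum_char_mul_eq_of_bandlimited`** — `Σ_{n∈ℤ} χ(n)V(δn) = (δq)⁻¹ τ(χ) Σ_{m∈ℤ} χ̄(m) G(m/(δq))`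
  for primitive `χ` mod `q`, `δ > 0` (the sum on the right is finite: `|m| < δq`);
* `summable_int_of_norm_le_div`, `summable_samples_of_bandlimited` — the two summability facts.

Consumer: Ramaré's Lemma 16 and Proposition 2 for even characters with Vaaler's `H`
(`VaalerFunctionIntegralRepresentation.lean`: `G = 2|t| + 2πt(1−|t|)cot πt`, `V = H′`).

## References

* [Ramare2001LOneApproximateFormulae] O. Ramaré, Acta Arith. 100 (2001), §II Lemma 1, (2.1), Lemma 3.
-/

noncomputable section

open Real Filter Topology Set MeasureTheory Asymptotics Complex

open scoped FourierTransform

namespace Literature.Analysis.Fourier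

/-- The Fourier transform (Mathlib normalisation `𝓕 f(ξ) = ∫ f(v)e^{−2πivξ} dv`) of the modulated
dilate `t ↦ L⁻¹ e(at/q) G(t/L)`, `L = δq`, is `ξ ↦ ∫ G(u) e(uδ(a − qξ)) du`. [cite: Ramare2001LOneApproximateFormulae, Lemma 1 p. 249 (proof)] -/
theorem fourier_modulated_dilate (G : ℝ → ℂ) {δ : ℝ} (hδ : 0 < δ) {q : ℝ} (hq : 0 < q)
    (a ξ : ℝ) :
    𝓕 (fun t : ℝ => (((δ * q)⁻¹ : ℝ) : ℂ) * (cexp (2 * π * I * (a / q) * t) * G (t / (δ * q)))) ξ =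
      ∫ u : ℝ, G u * cexp (2 * π * I * u * (δ * (a - q * ξ))) := by
  have hL : 0 < δ * q := mul_pos hδ hq
  have hδ0 : (δ : ℂ) ≠ 0 := by exact_mod_cast hδ.ne'
  have hq0 : (q : ℂ) ≠ 0 := by exact_mod_cast hq.ne'
  set g : ℝ → ℂ := fun u => G u * cexp (2 * π * I * u * (δ * (a - q * ξ))) with hg
  rw [Real.fourier_real_eq_integral_exp_smul]
  have h1 : ∀ v : ℝ, cexp (↑(-2 * π * v * ξ) * I) •
      ((((δ * q)⁻¹ : ℝ) : ℂ) * (cexp (2 * π * I * (a / q) * v) * G (v / (δ * q)))) =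
      (((δ * q)⁻¹ : ℝ) : ℂ) * g ((δ * q)⁻¹ * v) := by
    intro v
    simp only [hg, smul_eq_mul, div_eq_inv_mul]
    have e1 : cexp (↑(-2 * π * v * ξ) * I) * cexp (2 * π * I * ((q : ℂ)⁻¹ * a) * v) =
        cexp (2 * π * I * (((δ * q)⁻¹ * v : ℝ) : ℂ) * (δ * (a - q * ξ))) := by
      rw [← Complex.exp_add]
      congr 1
      push_cast
      field_simp
      ring
    calc cexp (↑(-2 * π * v * ξ) * I) * ((((δ * q)⁻¹ : ℝ) : ℂ) *
          (cexp (2 * π * I * ((q : ℂ)⁻¹ * a) * v) * G ((δ * q)⁻¹ * v)))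
        = (((δ * q)⁻¹ : ℝ) : ℂ) * (G ((δ * q)⁻¹ * v) *
          (cexp (↑(-2 * π * v * ξ) * I) * cexp (2 * π * I * ((q : ℂ)⁻¹ * a) * v))) := by ring
      _ = _ := by rw [e1]
  simp_rw [h1]
  rw [integral_const_mul, Measure.integral_comp_inv_mul_left g (δ * q), abs_of_pos hL, real_smul,
    ← mul_assoc]
  rw [show ((((δ * q)⁻¹ : ℝ) : ℂ) * ((δ * q : ℝ) : ℂ)) = 1 by
    rw [← Complex.ofReal_mul, inv_mul_cancel₀ hL.ne']; simp]
  rw [one_mul]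


/-- `|ξ|^{-2} = 1/ξ²` as a real power, for `ξ ≠ 0`. [folklore] -/
private theorem abs_rpow_neg_two (ξ : ℝ) : |ξ| ^ (-2 : ℝ) = 1 / ξ ^ 2 := by
  rw [Real.rpow_neg (abs_nonneg ξ), show (2:ℝ) = (2:ℕ) by norm_num, Real.rpow_natCast, sq_abs,
    one_div]

/-- **Poisson summation along the progression `a + qℤ` for a band-limited function.** Let `G` be
continuous with `G(u) = 0` for `|u| ≥ 1`, and `V(y) = ∫ G(u) e^{2πiuy} du` its (inverse) Fourier
integral, with `|V(y)| ≤ C/(1+y²)`. Then for `δ > 0`, `q ≥ 1` and `a ∈ ℤ`,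
`Σ_{k∈ℤ} V(δ(a + qk)) = (δq)⁻¹ Σ_{n∈ℤ} e(an/q) G(n/(δq))` (a finite sum on the right).
This is Mathlib's Poisson summation formula (`Real.tsum_eq_tsum_fourier_of_rpow_decay`) applied to
`t ↦ (δq)⁻¹ e(at/q) G(t/(δq))`, whose Fourier transform is `ξ ↦ V(δ(a − qξ))`. [cite: Ramare2001LOneApproximateFormulae, Lemma 1 p. 249] -/
theorem tsum_progression_eq_of_bandlimited {G : ℝ → ℂ} (hGc : Continuous G)
    (hG0 : ∀ u : ℝ, 1 ≤ |u| → G u = 0) {V : ℝ → ℂ}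
    (hV : ∀ y : ℝ, V y = ∫ u : ℝ, G u * cexp (2 * π * I * u * y))
    {C : ℝ} (hdec : ∀ y : ℝ, ‖V y‖ ≤ C / (1 + y ^ 2))
    {δ : ℝ} (hδ : 0 < δ) {q : ℕ} (hq : 0 < q) (a : ℤ) :
    ∑' k : ℤ, V (δ * (a + q * k)) =
      (((δ * q)⁻¹ : ℝ) : ℂ) *
        ∑' n : ℤ, cexp (2 * π * I * ((a : ℝ) / (q : ℝ) : ℝ) * (n : ℝ)) * G (n / (δ * q)) := by
  have hq' : (0 : ℝ) < q := by exact_mod_cast hq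
  have hL : 0 < δ * q := mul_pos hδ hq'
  have hC : 0 ≤ C := by
    have := hdec 0
    have h0 : (0:ℝ) ≤ C / (1 + 0 ^ 2) := (norm_nonneg _).trans this
    simpa using h0
  set f : ℝ → ℂ := fun t => (((δ * q)⁻¹ : ℝ) : ℂ) *
    (cexp (2 * π * I * ((a : ℝ) / (q : ℝ) : ℝ) * t) * G (t / (δ * q))) with hf
  -- continuity
  have hc : Continuous f := by
    have : Continuous fun t : ℝ => G (t / (δ * q)) := hGc.comp (continuous_id.div_const _)
    simp only [hf]
    fun_prop
  -- `f` vanishes for `|t| ≥ δq`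
  have hzero : ∀ t : ℝ, δ * q ≤ |t| → f t = 0 := by
    intro t ht
    have : G (t / (δ * q)) = 0 := hG0 _ (by rw [abs_div, abs_of_pos hL, le_div_iff₀ hL]; linarith)
    simp [hf, this]
  have hf_dec : f =O[cocompact ℝ] fun t : ℝ => |t| ^ (-2 : ℝ) := by
    refine IsBigO.of_bound 0 ?_
    rw [cocompact_eq_atBot_atTop, eventually_sup]
    constructor
    · filter_upwards [eventually_le_atBot (-(δ * q))] with t ht
      rw [hzero t (by rw [abs_of_nonpos (by linarith)]; linarith), norm_zero, zero_mul]
    · filter_upwards [eventually_ge_atTop (δ * q)] with t ht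
      rw [hzero t (by rw [abs_of_nonneg (by linarith)]; linarith), norm_zero, zero_mul]
  -- the Fourier transform of `f`
  have hFf_eq : ∀ ξ : ℝ, 𝓕 f ξ = V (δ * (a - q * ξ)) := by
    intro ξ
    rw [hV, hf]
    have h := fourier_modulated_dilate G hδ hq' (a : ℝ) ξ
    push_cast at h ⊢
    rw [h]
  have hFf_dec : 𝓕 f =O[cocompact ℝ] fun t : ℝ => |t| ^ (-2 : ℝ) := by
    refine IsBigO.of_bound (4 * C / (δ ^ 2 * q ^ 2)) ?_
    have key : ∀ ξ : ℝ, 2 * |(a : ℝ)| / q + 2 ≤ |ξ| →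
        ‖𝓕 f ξ‖ ≤ 4 * C / (δ ^ 2 * q ^ 2) * ‖|ξ| ^ (-2 : ℝ)‖ := by
      intro ξ hξ
      have hξ0 : ξ ≠ 0 := by
        intro h; rw [h, abs_zero] at hξ; have : (0:ℝ) ≤ 2 * |(a:ℝ)| / q := by positivity
        linarith
      rw [hFf_eq, Real.norm_eq_abs, abs_of_nonneg (Real.rpow_nonneg (abs_nonneg _) _),
        abs_rpow_neg_two ξ]
      have h1 : (q : ℝ) * |ξ| / 2 ≤ |(a : ℝ) - q * ξ| := by
        have hqa : 2 * |(a:ℝ)| ≤ q * |ξ| := by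
          have := mul_le_mul_of_nonneg_left hξ hq'.le
          rw [mul_add, mul_div_cancel₀ _ hq'.ne'] at this
          nlinarith [abs_nonneg ξ]
        have := abs_sub_abs_le_abs_sub ((q : ℝ) * ξ) a
        rw [abs_mul, abs_of_pos hq', abs_sub_comm] at this
        linarith
      have h2 : δ ^ 2 * q ^ 2 * ξ ^ 2 / 4 ≤ 1 + (δ * (a - q * ξ)) ^ 2 := by
        have h3 : (q : ℝ) ^ 2 * ξ ^ 2 / 4 ≤ ((a : ℝ) - q * ξ) ^ 2 := by
          have h0 : 0 ≤ (q : ℝ) * |ξ| / 2 := by positivity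
          have := pow_le_pow_left₀ h0 h1 2
          rw [sq_abs] at this
          nlinarith [sq_abs ξ]
        nlinarith [sq_nonneg δ]
      calc ‖V (δ * (a - q * ξ))‖ ≤ C / (1 + (δ * (a - q * ξ)) ^ 2) := hdec _
        _ ≤ C / (δ ^ 2 * q ^ 2 * ξ ^ 2 / 4) := by
            apply div_le_div_of_nonneg_left hC (by positivity) h2
        _ = 4 * C / (δ ^ 2 * q ^ 2) * (1 / ξ ^ 2) := by field_simp
    rw [cocompact_eq_atBot_atTop, eventually_sup]
    constructor
    · filter_upwards [eventually_le_atBot (-(2 * |(a : ℝ)| / q + 2))] with ξ hξ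
      have h0 : (0:ℝ) ≤ 2 * |(a:ℝ)| / q := by positivity
      exact key ξ (by rw [abs_of_nonpos (show ξ ≤ 0 by linarith)]; linarith)
    · filter_upwards [eventually_ge_atTop (2 * |(a : ℝ)| / q + 2)] with ξ hξ
      have h0 : (0:ℝ) ≤ 2 * |(a:ℝ)| / q := by positivity
      exact key ξ (by rw [abs_of_nonneg (show (0:ℝ) ≤ ξ by linarith)]; linarith)
  -- Poisson summation at `x = 0`
  have hP := Real.tsum_eq_tsum_fourier_of_rpow_decay hc one_lt_two hf_dec hFf_dec 0
  simp only [zero_add, QuotientAddGroup.mk_zero, fourier_eval_zero, mul_one] at hP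
  -- left side of Poisson = the finite dual sum
  have hleft : ∑' n : ℤ, f n = (((δ * q)⁻¹ : ℝ) : ℂ) *
      ∑' n : ℤ, cexp (2 * π * I * ((a : ℝ) / (q : ℝ) : ℝ) * (n : ℝ)) * G (n / (δ * q)) := by
    rw [← tsum_mul_left]
  -- right side of Poisson = the progression sum, after `n ↦ −k`
  have hright : ∑' n : ℤ, 𝓕 f n = ∑' k : ℤ, V (δ * (a + q * k)) := by
    simp_rw [hFf_eq]
    rw [← (Equiv.neg ℤ).tsum_eq]
    refine tsum_congr fun k => ?_
    simp only [Equiv.neg_apply, Int.cast_neg]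
    ring_nf
  rw [← hright, ← hP, hleft]


/-! ## Summing over residue classes, and the twist by a primitive Dirichlet character -/

/-- **Sum over `ℤ` by residue classes mod `q`**: for summable `F` and a `q`-periodic weight `c`,
`Σ_{n∈ℤ} c(n) F(n) = Σ_{r<q} c(r) Σ_{k∈ℤ} F(r + qk)`. [cite: Ramare2001LOneApproximateFormulae, Lemma 1 p. 249 (proof: «split the first sum in arithmetic progressions modulo q»)] -/
theorem tsum_int_eq_sum_residues {q : ℕ} [NeZero q] (c : ZMod q → ℂ) {F : ℤ → ℂ}
    (hF : Summable F) :
    ∑' n : ℤ, c n * F n = ∑ r : Fin q, c (r : ℕ) * ∑' k : ℤ, F (r + q * k) := by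
  set e := (Int.divModEquiv q).symm with he
  have heval : ∀ p : ℤ × Fin q, e p = p.1 * q + (p.2 : ℕ) := fun p => rfl
  have h1 : ∑' n : ℤ, c n * F n = ∑' p : ℤ × Fin q, c (e p) * F (e p) :=
    (e.tsum_eq (fun n => c n * F n)).symm
  rw [h1]
  have hsum : Summable fun p : ℤ × Fin q => c (e p) * F (e p) := by
    have h2 : Summable fun p : ℤ × Fin q => F (e p) := (e.summable_iff).2 hF
    refine Summable.of_norm_bounded (g := fun p => (Finset.univ.sup' Finset.univ_nonempty
      fun r : Fin q => ‖c (r : ℕ)‖) * ‖F (e p)‖) (h2.norm.mul_left _) fun p => ?_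
    rw [norm_mul]
    refine mul_le_mul_of_nonneg_right ?_ (norm_nonneg _)
    have : c (e p) = c ((p.2 : ℕ) : ZMod q) := by
      rw [heval]; push_cast; simp
    rw [this]
    exact Finset.le_sup' (fun r : Fin q => ‖c (r : ℕ)‖) (Finset.mem_univ p.2)
  have hfib : ∀ k : ℤ, Summable fun r : Fin q => c (e (k, r)) * F (e (k, r)) := fun k =>
    (hasSum_fintype _).summable
  rw [hsum.tsum_prod' hfib]
  simp_rw [tsum_fintype]
  have hcol : ∀ r : Fin q, Summable fun k : ℤ => c (e (k, r)) * F (e (k, r)) := by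
    intro r
    have hinj : Function.Injective fun k : ℤ => (k * q + (r : ℕ) : ℤ) := by
      intro k₁ k₂ h
      simpa [NeZero.ne q] using h
    have := (hF.comp_injective hinj).mul_left (c (r : ℕ))
    refine this.congr fun k => ?_
    simp only [Function.comp, heval]
    congr 1
    push_cast; simp
  rw [Summable.tsum_finsetSum (fun r _ => hcol r)]
  refine Finset.sum_congr rfl fun r _ => ?_
  rw [← tsum_mul_left]
  refine tsum_congr fun k => ?_
  rw [heval]
  congr 1
  · push_cast; simp
  · congr 1; push_cast; ring

/-- The same with the residues indexed by `ZMod q` (via `ZMod.val`). [cite: Ramare2001LOneApproximateFormulae, Lemma 1 p. 249 (proof)] -/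
theorem tsum_int_eq_sum_residues_zmod {q : ℕ} [NeZero q] (c : ZMod q → ℂ) {F : ℤ → ℂ}
    (hF : Summable F) :
    ∑' n : ℤ, c n * F n = ∑ b : ZMod q, c b * ∑' k : ℤ, F (b.val + q * k) := by
  obtain ⟨n, rfl⟩ : ∃ n, q = n + 1 := ⟨q - 1, by have := NeZero.pos q; omega⟩
  rw [tsum_int_eq_sum_residues c hF]
  refine Finset.sum_congr rfl fun b _ => ?_
  congr 1
  have hb := @ZMod.natCast_zmod_val (n + 1) _ b
  exact congrArg c hb

/-- `Σ_{b mod q} χ(b) e(bm/q) = χ⁻¹(m) τ(χ)` for a primitive character `χ` mod `q` (Mathlib's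
`gaussSum_mulShift_of_isPrimitive`, with the exponential written out via `ZMod.val`). [cite: Ramare2001LOneApproximateFormulae, (2.1) p. 249] -/
theorem sum_char_mul_exp_eq {q : ℕ} [NeZero q] {χ : DirichletCharacter ℂ q}
    (hχ : χ.IsPrimitive) (m : ℤ) :
    ∑ b : ZMod q, χ b * cexp (2 * π * I * (((b.val : ℕ) : ℝ) / (q : ℝ) : ℝ) * (m : ℝ)) =
      χ⁻¹ (m : ZMod q) * gaussSum χ (ZMod.stdAddChar (N := q)) := by
  rw [← gaussSum_mulShift_of_isPrimitive _ hχ, gaussSum]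
  refine Finset.sum_congr rfl fun b _ => ?_
  rw [AddChar.mulShift_apply]
  congr 1
  rw [show ((m : ZMod q) * b) = ((m * (b.val : ℕ) : ℤ) : ZMod q) by
      push_cast; rw [ZMod.natCast_zmod_val],
    ZMod.stdAddChar_coe]
  congr 1
  push_cast
  ring


/-- A sequence on `ℤ` dominated by `C/(1 + δ²n²)` (`δ > 0`) is summable. [cite: Ramare2001LOneApproximateFormulae, Lemma 3 p. 250 (proof)] -/
theorem summable_int_of_norm_le_div {F : ℤ → ℂ} {C δ : ℝ} (hδ : 0 < δ)
    (h : ∀ n : ℤ, ‖F n‖ ≤ C / (1 + (δ * n) ^ 2)) : Summable F := by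
  have hC : 0 ≤ C := by
    have := (norm_nonneg _).trans (h 0)
    simpa using this
  refine Summable.of_norm_bounded_eventually
    (((summable_one_div_int_pow (p := 2)).2 one_lt_two).mul_left (C / δ ^ 2)) ?_
  filter_upwards [eventually_cofinite_ne 0] with n hn
  have hn' : (n : ℝ) ≠ 0 := by exact_mod_cast hn
  have hn2 : 0 < (n : ℝ) ^ 2 := by positivity
  calc ‖F n‖ ≤ C / (1 + (δ * n) ^ 2) := h n
    _ ≤ C / (δ ^ 2 * (n : ℝ) ^ 2) :=
        div_le_div_of_nonneg_left hC (by positivity) (by nlinarith)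
    _ = C / δ ^ 2 * (1 / (n : ℝ) ^ 2) := by field_simp

/-- Samples `m ↦ w(m) G(m/L)` of a function vanishing off `(−1,1)` form a finitely supported, hence
summable, sequence. [cite: Ramare2001LOneApproximateFormulae, Lemma 3 p. 250 (proof)] -/
theorem summable_samples_of_bandlimited {G : ℝ → ℂ} (hG0 : ∀ u : ℝ, 1 ≤ |u| → G u = 0)
    (w : ℤ → ℂ) {L : ℝ} (hL : 0 < L) : Summable fun m : ℤ => w m * G (m / L) := by
  apply summable_of_hasFiniteSupport
  refine (Set.finite_Icc (-⌈L⌉) ⌈L⌉).subset fun m hm => ?_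
  rw [Function.mem_support] at hm
  rw [Set.mem_Icc]
  by_contra hcon
  apply hm
  have : 1 ≤ |(m : ℝ) / L| := by
    rw [abs_div, abs_of_pos hL, le_div_iff₀ hL, one_mul]
    have hL' : L ≤ ⌈L⌉ := Int.le_ceil L
    rcases not_and_or.1 hcon with h1 | h1
    · push Not at h1
      have : (m : ℝ) ≤ -⌈L⌉ := by exact_mod_cast (show m ≤ -⌈L⌉ by omega)
      rw [abs_of_nonpos (by linarith)]
      linarith
    · push Not at h1
      have : (⌈L⌉ : ℝ) ≤ m := by exact_mod_cast (show ⌈L⌉ ≤ m by omega)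
      rw [abs_of_nonneg (by linarith)]
      linarith
  rw [hG0 _ this, mul_zero]

/-- **Twisted Poisson summation for a band-limited function**: for a primitive Dirichlet character `χ`
mod `q` and `G`, `V` as in `tsum_progression_eq_of_bandlimited`,
`Σ_{n∈ℤ} χ(n) V(δn) = (δq)⁻¹ τ(χ) Σ_{m∈ℤ} χ̄(m) G(m/(δq))`, `τ(χ) = Σ_b χ(b)e(b/q)` (splitting into
residue classes, Poisson along each progression, and `Σ_b χ(b) e(bm/q) = χ̄(m)τ(χ)`). This is the
"twisted Poisson summation formula" of Berndt / Ramaré's Lemma 1 with (2.1), for band-limited test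
functions. [cite: Ramare2001LOneApproximateFormulae, Lemma 1 and (2.1), p. 249] -/
theorem tsum_char_mul_eq_of_bandlimited {q : ℕ} [NeZero q] {χ : DirichletCharacter ℂ q}
    (hχ : χ.IsPrimitive) {G : ℝ → ℂ} (hGc : Continuous G)
    (hG0 : ∀ u : ℝ, 1 ≤ |u| → G u = 0) {V : ℝ → ℂ}
    (hV : ∀ y : ℝ, V y = ∫ u : ℝ, G u * cexp (2 * π * I * u * y))
    {C : ℝ} (hdec : ∀ y : ℝ, ‖V y‖ ≤ C / (1 + y ^ 2)) {δ : ℝ} (hδ : 0 < δ) :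
    ∑' n : ℤ, χ n * V (δ * n) =
      (((δ * q)⁻¹ : ℝ) : ℂ) * gaussSum χ (ZMod.stdAddChar (N := q)) *
        ∑' m : ℤ, χ⁻¹ (m : ZMod q) * G (m / (δ * q)) := by
  have hq : 0 < q := Nat.pos_of_ne_zero (NeZero.ne q)
  have hq' : (0:ℝ) < q := by exact_mod_cast hq
  have hL : 0 < δ * q := mul_pos hδ hq'
  have hF : Summable fun n : ℤ => V (δ * n) :=
    summable_int_of_norm_le_div (C := C) hδ fun n => hdec _
  rw [tsum_int_eq_sum_residues_zmod (fun b => χ b) hF]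
  have hinner : ∀ b : ZMod q, ∑' k : ℤ, V (δ * ((b.val + q * k : ℤ) : ℝ)) =
      (((δ * q)⁻¹ : ℝ) : ℂ) * ∑' m : ℤ,
        cexp (2 * π * I * (((b.val : ℤ) : ℝ) / (q : ℝ) : ℝ) * (m : ℝ)) * G (m / (δ * q)) := by
    intro b
    have h := tsum_progression_eq_of_bandlimited hGc hG0 hV hdec hδ hq (b.val : ℤ)
    rw [← h]
    refine tsum_congr fun k => ?_
    push_cast
    ring_nf
  simp_rw [hinner]
  -- regroup: `Σ_b χ(b) (L⁻¹ Σ_m e G) = L⁻¹ Σ_m G (Σ_b χ(b) e)`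
  have hsm : ∀ b : ZMod q, Summable fun m : ℤ =>
      χ b * (cexp (2 * π * I * (((b.val : ℤ) : ℝ) / (q : ℝ) : ℝ) * (m : ℝ)) * G (m / (δ * q))) := by
    intro b
    have := summable_samples_of_bandlimited hG0
      (fun m : ℤ => χ b * cexp (2 * π * I * (((b.val : ℤ) : ℝ) / (q : ℝ) : ℝ) * (m : ℝ))) hL
    refine this.congr fun m => ?_
    ring
  calc ∑ b : ZMod q, χ b * ((((δ * q)⁻¹ : ℝ) : ℂ) * ∑' m : ℤ,
        cexp (2 * π * I * (((b.val : ℤ) : ℝ) / (q : ℝ) : ℝ) * (m : ℝ)) * G (m / (δ * q)))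
      = (((δ * q)⁻¹ : ℝ) : ℂ) * ∑ b : ZMod q, ∑' m : ℤ,
          χ b * (cexp (2 * π * I * (((b.val : ℤ) : ℝ) / (q : ℝ) : ℝ) * (m : ℝ)) * G (m / (δ * q))) := by
        rw [Finset.mul_sum]
        refine Finset.sum_congr rfl fun b _ => ?_
        rw [mul_left_comm, ← tsum_mul_left]
    _ = (((δ * q)⁻¹ : ℝ) : ℂ) * ∑' m : ℤ, ∑ b : ZMod q,
          χ b * (cexp (2 * π * I * (((b.val : ℤ) : ℝ) / (q : ℝ) : ℝ) * (m : ℝ)) * G (m / (δ * q))) := by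
        rw [Summable.tsum_finsetSum (fun b _ => hsm b)]
    _ = (((δ * q)⁻¹ : ℝ) : ℂ) * ∑' m : ℤ, (χ⁻¹ (m : ZMod q) * gaussSum χ (ZMod.stdAddChar (N := q)))
          * G (m / (δ * q)) := by
        congr 1
        refine tsum_congr fun m => ?_
        rw [← sum_char_mul_exp_eq hχ m, Finset.sum_mul]
        refine Finset.sum_congr rfl fun b _ => ?_
        push_cast
        ring
    _ = _ := by
        rw [mul_assoc]
        congr 1
        rw [← tsum_mul_left]
        exact tsum_congr fun m => by ring

end Literature.Analysis.Fourier
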